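import Mathlib
import Literature.MathematicalPhysics.QuantumFieldTheory.MirrorSlabTranslationHolomorphy
import Literature.Analysis.Complex.LocalCrossTheorem
import HarnessLib

/-!
# Directional analyticity of reflection-positive correlation functions in one point

Topic `Literature/MathematicalPhysics/QuantumFieldTheory`.  Continuation of
`MirrorSlabTranslationHolomorphy.lean` (the one-mirror lemma) with the local cross theorem of
`Literature/Analysis/Complex/LocalCrossTheorem.lean`.

**Theorem (`eventually_exists_disc_extension_pointShift`).**  Let `S : CorrFamily d` be permutation
symmetric, translation invariant, continuous off the diagonals, with two-cluster functions of the
mirror `n^⊥` (`n ≠ 0`) holomorphic in the normal translation of the second cluster (hypothesis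
`hH`, Glimm–Jaffe Thm. 6.1.3 at one point of the mirror plane).  Let `z₀` be an injective
configuration and `i₀` an index such that the height `⟪z₀ i₀, n⟫` differs from all other heights
`⟪z₀ j, n⟫` ("`n` is a good direction for the point `z₀ i₀`").  Then there are `r > 0` and `M` such
that for every configuration `z` near `z₀` the function `t ↦ S N (z with z i₀ := z i₀ + t n)` —
moving ONE point along the normal — is on `(-r, r)` the restriction of a function holomorphic on
the disc of radius `r` and bounded by `M`.

**Proof** (Glimm–Jaffe §6.1 + Bernstein's cross theorem).  Let `J` be the indices strictly above
`z₀ i₀` and `J₀ = J ∪ {i₀}`.  A mirror strictly between the points below `z₀ i₀` and `J₀` makes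
`u ↦ S(z + u·1_{J₀} n)` holomorphic near `0` (one-mirror lemma), a mirror strictly between
`{z₀ i₀} ∪ (below)` and `J` makes `v ↦ S(z + v·1_J n)` holomorphic near `0`, both locally uniformly
in `z`.  Hence `H(u, v) = S(z + u·1_{J₀} n + v·1_J n)` is separately extendable with uniform
radius and bound, and the diagonal corollary of the local cross theorem
(`exists_holomorphic_extension_diagonal_of_separately_two_local`) extends
`t ↦ H(t, -t) = S(z with z i₀ := z i₀ + t n)`.

## References
* J. Glimm, A. Jaffe, *Quantum Physics* (2nd ed. 1987), §6.1 Thm. 6.1.3. [GlimmJaffe1987]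
* M. Jarnicki, P. Pflug, *Separately Analytic Functions* (EMS 2011), Ch. 5. [JarnickiPflug2011]
-/

noncomputable section

open scoped InnerProductSpace BigOperators
open Literature.Probability.LatticeModels Literature.Analysis.Complex _root_.Filter _root_.Set
  _root_.Metric
open scoped _root_.Topology

namespace Literature.MathematicalPhysics.QuantumFieldTheory

variable {d : ℕ} {S : CorrFamily d} {n : EuclideanSpace ℝ (Fin d)}

/-- A positive margin below finitely many strict inequalities: if `f j < c` for all `j` with
`p j`, then `f j < c - g` for some `g > 0`. [folklore] -/
theorem exists_pos_margin_lt {ι : Type*} [Finite ι] {p : ι → Prop} {f : ι → ℝ} {c : ℝ}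
    (h : ∀ j, p j → f j < c) : ∃ g > 0, ∀ j, p j → f j < c - g := by
  have hev : ∀ᶠ g in 𝓝 (0 : ℝ), ∀ j, p j → f j < c - g := by
    refine Filter.eventually_all.2 fun j => ?_
    by_cases hj : p j
    · have hc : ContinuousAt (fun g : ℝ => c - g) 0 := (continuous_const.sub continuous_id).continuousAt
      have : f j < c - 0 := by simpa using h j hj
      exact (continuousAt_const.eventually_lt hc this).mono fun g hg _ => hg
    · exact Filter.Eventually.of_forall fun g h' => absurd h' hj
  have hev' : ∀ᶠ g in 𝓝[>] (0 : ℝ), (∀ j, p j → f j < c - g) ∧ 0 < g :=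
    (hev.filter_mono nhdsWithin_le_nhds).and self_mem_nhdsWithin
  obtain ⟨g, hg, hg0⟩ := hev'.exists
  exact ⟨g, hg0, hg⟩

/-- A positive margin above finitely many strict inequalities: if `c < f j` for all `j` with
`p j`, then `c + g < f j` for some `g > 0`. [folklore] -/
theorem exists_pos_margin_gt {ι : Type*} [Finite ι] {p : ι → Prop} {f : ι → ℝ} {c : ℝ}
    (h : ∀ j, p j → c < f j) : ∃ g > 0, ∀ j, p j → c + g < f j := by
  obtain ⟨g, hg, hlt⟩ := exists_pos_margin_lt (p := p) (f := fun j => -f j) (c := -c)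
    fun j hj => by linarith [h j hj]
  exact ⟨g, hg, fun j hj => by linarith [hlt j hj]⟩

/-- Moving the parts `1_{J₀}` and `1_J` of a configuration by `u`, `v` along `n` moves it by at most
`(|u| + |v|) ‖n‖` in the sup distance. [folklore] -/
theorem dist_twoShift_le {N : ℕ} (J₀ J : Finset (Fin N)) (z : Fin N → EuclideanSpace ℝ (Fin d))
    (u v : ℝ) :
    dist (fun j => z j + (if j ∈ J₀ then u else 0) • n + (if j ∈ J then v else 0) • n) z ≤
      (|u| + |v|) * ‖n‖ := by
  refine (dist_pi_le_iff (by positivity)).2 fun j => ?_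
  rw [dist_eq_norm, add_assoc, add_sub_cancel_left]
  refine (norm_add_le _ _).trans ?_
  rw [norm_smul, norm_smul, Real.norm_eq_abs, Real.norm_eq_abs, add_mul]
  have hu : |(if j ∈ J₀ then u else 0)| ≤ |u| := by split_ifs <;> simp
  have hv : |(if j ∈ J then v else 0)| ≤ |v| := by split_ifs <;> simp
  exact add_le_add (mul_le_mul_of_nonneg_right hu (norm_nonneg _))
    (mul_le_mul_of_nonneg_right hv (norm_nonneg _))

/-- **Directional analyticity in one point, locally uniformly** (Glimm–Jaffe §6.1 + the local cross
theorem).  Let `S` be permutation symmetric, translation invariant, continuous off the diagonals,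
with two-cluster functions of the mirror `n^⊥` (`n ≠ 0`) holomorphic in the normal translation of
the second cluster.  If `z₀` is injective and the height `⟪z₀ i₀, n⟫` differs from all other heights
`⟪z₀ j, n⟫`, then there are `r > 0` and `M` such that for all `z` near `z₀` the function
`t ↦ S N (z with z i₀ := z i₀ + t n)` is on `(-r, r)` the restriction of a function holomorphic on
the disc of radius `r` and bounded by `M`. [cite: GlimmJaffe1987, §6.1 Thm. 6.1.3] -/
theorem eventually_exists_disc_extension_pointShift (hn : n ≠ 0)
    (hP : IsPermutationSymmetric S) (hT : IsTranslationInvariant S)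
    (hC : ∀ k, ContinuousOn (S k) (NonCoincident d k))
    (hH : ∀ (k : ℕ) (A : Fin k → EuclideanSpace ℝ (Fin d)) (k' : ℕ)
      (B : Fin k' → EuclideanSpace ℝ (Fin d)), (∀ a, 0 < ⟪A a, n⟫_ℝ) → (∀ b, 0 < ⟪B b, n⟫_ℝ) →
      ∃ Φ : ℂ → ℂ, DifferentiableOn ℂ Φ {t : ℂ | 0 < t.re} ∧
        (∀ t : ℝ, 0 < t → Φ t = ((S (k + k')
          (Fin.append (fun a => (ℝ ∙ n)ᗮ.reflection (A a)) (fun b => B b + t • n)) : ℝ) : ℂ)) ∧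
        ∀ t : ℂ, 0 < t.re → ‖Φ t‖ ^ 2 ≤
          S (k + k) (Fin.append (fun a => (ℝ ∙ n)ᗮ.reflection (A a)) A) *
          S (k' + k') (Fin.append (fun b => (ℝ ∙ n)ᗮ.reflection (B b)) B))
    {N : ℕ} {z₀ : Fin N → EuclideanSpace ℝ (Fin d)} (hz₀ : Function.Injective z₀) (i₀ : Fin N)
    (hgood : ∀ j, j ≠ i₀ → ⟪z₀ j, n⟫_ℝ ≠ ⟪z₀ i₀, n⟫_ℝ) :
    ∃ r > 0, ∃ M : ℝ, ∀ᶠ z in 𝓝 z₀, ∃ g : ℂ → ℂ, DifferentiableOn ℂ g (ball (0 : ℂ) r) ∧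
      (∀ w ∈ ball (0 : ℂ) r, ‖g w‖ ≤ M) ∧
      ∀ t : ℝ, |t| < r → g t = ((S N (Function.update z i₀ (z i₀ + t • n)) : ℝ) : ℂ) := by
  classical
  set c : ℝ := ⟪z₀ i₀, n⟫_ℝ with hc
  set J : Finset (Fin N) := Finset.univ.filter fun j => c < ⟪z₀ j, n⟫_ℝ with hJ
  set J₀ : Finset (Fin N) := Finset.univ.filter fun j => c ≤ ⟪z₀ j, n⟫_ℝ with hJ₀
  have hmJ : ∀ j, j ∈ J ↔ c < ⟪z₀ j, n⟫_ℝ := fun j => by simp [hJ]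
  have hmJ₀ : ∀ j, j ∈ J₀ ↔ c ≤ ⟪z₀ j, n⟫_ℝ := fun j => by simp [hJ₀]
  have hi₀J : i₀ ∉ J := by rw [hmJ]; exact lt_irrefl _
  have hi₀J₀ : i₀ ∈ J₀ := by rw [hmJ₀]
  have hJJ₀ : ∀ j, j ≠ i₀ → (j ∈ J₀ ↔ j ∈ J) := fun j hj => by
    rw [hmJ, hmJ₀]
    exact ⟨fun h => lt_of_le_of_ne h (hgood j hj).symm, le_of_lt⟩
  -- the two gaps
  obtain ⟨g₁, hg₁, hgap₁⟩ : ∃ g > 0, ∀ j, j ∉ J₀ → ⟪z₀ j, n⟫_ℝ < c - g :=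
    exists_pos_margin_lt fun j hj => by rwa [hmJ₀, not_le] at hj
  obtain ⟨g₂, hg₂, hgap₂⟩ : ∃ g > 0, ∀ j, j ∈ J → c + g < ⟪z₀ j, n⟫_ℝ :=
    exists_pos_margin_gt fun j hj => by rwa [hmJ] at hj
  -- the one-mirror lemma for `J₀` (mirror between the lower points and `z₀ i₀`)
  obtain ⟨ρ₁, hρ₁, M₁, hE₁⟩ := eventually_exists_halfPlane_extension_slabShift hn hP hT hC hH J₀ hz₀
    (h₀ := c - g₁ / 2) (τ := g₁ / 4) (by positivity)
    (fun i hi => by linarith [hgap₁ i hi])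
    (fun i hi => by have := (hmJ₀ i).1 hi; linarith)
  -- the one-mirror lemma for `J` (mirror between `z₀ i₀` and the upper points)
  obtain ⟨ρ₂, hρ₂, M₂, hE₂⟩ := eventually_exists_halfPlane_extension_slabShift hn hP hT hC hH J hz₀
    (h₀ := c + g₂ / 2) (τ := g₂ / 4) (by positivity)
    (fun i hi => by have := (not_lt.1 (mt (hmJ i).2 hi)); linarith)
    (fun i hi => by linarith [hgap₂ i hi])
  obtain ⟨ε, hε, hball⟩ := Metric.eventually_nhds_iff.1 (hE₁.and hE₂)
  -- scales
  have hnpos : 0 < ‖n‖ := norm_pos_iff.2 hn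
  set ℓ₀ : ℝ := ε / (4 * ‖n‖) with hℓ₀
  have hℓ₀pos : 0 < ℓ₀ := by positivity
  set ℓ : ℝ := min ℓ₀ (min ρ₁ ρ₂) with hℓdef
  have hℓ : 0 < ℓ := lt_min hℓ₀pos (lt_min hρ₁ hρ₂)
  have hℓ₁ : ℓ ≤ ρ₁ := (min_le_right _ _).trans (min_le_left _ _)
  have hℓ₂ : ℓ ≤ ρ₂ := (min_le_right _ _).trans (min_le_right _ _)
  have hℓℓ₀ : ℓ ≤ ℓ₀ := min_le_left _ _
  obtain ⟨r, hr, hcross⟩ := exists_holomorphic_extension_diagonal_of_separately_two_local ℓ hℓ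
  -- the shifted configurations stay in the good ball
  have hnear : ∀ z : Fin N → EuclideanSpace ℝ (Fin d), dist z z₀ < ε / 2 → ∀ u v : ℝ, |u| < ℓ →
      |v| < ℓ → dist (fun j => z j + (if j ∈ J₀ then u else 0) • n + (if j ∈ J then v else 0) • n)
        z₀ < ε := by
    intro z hz u v hu hv
    have h1 := dist_twoShift_le (n := n) J₀ J z u v
    have h2 : (|u| + |v|) * ‖n‖ < ε / 2 := by
      have : |u| + |v| < 2 * ℓ₀ := by linarith
      calc (|u| + |v|) * ‖n‖ < 2 * ℓ₀ * ‖n‖ := by gcongr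
        _ = ε / 2 := by rw [hℓ₀]; field_simp; ring
    calc dist _ z₀ ≤ dist _ z + dist z z₀ := dist_triangle _ _ _
      _ < ε / 2 + ε / 2 := by linarith
      _ = ε := by ring
  -- a disc inside a half-plane
  have hdisc : ∀ {ρ : ℝ}, ℓ ≤ ρ → ball (0 : ℂ) ℓ ⊆ {w : ℂ | -ρ < w.re} := fun hρ w hw => by
    rw [mem_ball_zero_iff] at hw
    have := Complex.abs_re_le_norm w
    simp only [mem_setOf_eq]
    linarith [(abs_lt.1 (this.trans_lt hw)).1]
  refine ⟨r, hr, max M₁ M₂, ?_⟩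
  have hmem : ball z₀ (ε / 2) ∈ 𝓝 z₀ := ball_mem_nhds _ (by positivity)
  filter_upwards [hmem] with z hz
  rw [mem_ball] at hz
  -- the two-parameter function
  set H : ℝ → ℝ → ℂ := fun u v =>
    ((S N (fun j => z j + (if j ∈ J₀ then u else 0) • n + (if j ∈ J then v else 0) • n) : ℝ) : ℂ)
    with hHdef
  obtain ⟨g, hgd, hgb, hgr⟩ := hcross (max M₁ M₂) H
    (fun v hv => by
      -- slices in `u`: the one-mirror lemma for `J₀` at the configuration shifted by `v·1_J n`
      have hgoodv := (hball (hnear z hz 0 v (by simpa using hℓ) hv)).1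
      simp only [ite_self, zero_smul, add_zero] at hgoodv
      obtain ⟨Φ, hΦd, hΦr, hΦb⟩ := hgoodv
      refine ⟨Φ, hΦd.mono (hdisc hℓ₁), fun w hw => (hΦb w (hdisc hℓ₁ hw)).trans (le_max_left _ _),
        fun u hu => ?_⟩
      rw [hΦr u (by linarith [(abs_lt.1 hu).1]), hHdef]
      dsimp only
      congr 2
      funext j
      rw [add_right_comm])
    (fun u hu => by
      -- slices in `v`: the one-mirror lemma for `J` at the configuration shifted by `u·1_{J₀} n`
      have hgoodu := (hball (hnear z hz u 0 hu (by simpa using hℓ))).2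
      simp only [ite_self, zero_smul, add_zero] at hgoodu
      obtain ⟨Φ, hΦd, hΦr, hΦb⟩ := hgoodu
      refine ⟨Φ, hΦd.mono (hdisc hℓ₂), fun w hw => (hΦb w (hdisc hℓ₂ hw)).trans (le_max_right _ _),
        fun v hv => ?_⟩
      rw [hΦr v (by linarith [(abs_lt.1 hv).1]), hHdef])
  refine ⟨g, hgd, hgb, fun t ht => ?_⟩
  rw [hgr t ht, hHdef]
  dsimp only
  congr 2
  funext j
  by_cases hj : j = i₀
  · subst hj
    rw [Function.update_self, if_pos hi₀J₀, if_neg hi₀J, zero_smul, add_zero]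
  · rw [Function.update_of_ne hj]
    by_cases hjJ : j ∈ J
    · rw [if_pos hjJ, if_pos ((hJJ₀ j hj).2 hjJ), neg_smul, add_neg_cancel_right]
    · rw [if_neg hjJ, if_neg (mt (hJJ₀ j hj).1 hjJ), zero_smul, add_zero, add_zero]

end Literature.MathematicalPhysics.QuantumFieldTheory

end
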